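import Summits.AtomisticToContinuum.BoseEinsteinCondensation.Theses.BECInfDivCoherence
import Summits.AtomisticToContinuum.BoseEinsteinCondensation.Theorems.BECInfDivCoherenceGridInfDivCoherenceGridCharacterSum
import Summits.AtomisticToContinuum.BoseEinsteinCondensation.Theorems.BECInfDivCoherenceGridInfDivCoherenceSchoenbergLimit
import Summits.AtomisticToContinuum.BoseEinsteinCondensation.Theorems.BECInfDivCoherenceGridInfDivCoherenceCohGridEven
import Summits.AtomisticToContinuum.BoseEinsteinCondensation.Theorems.BECInfDivCoherenceGridInfDivCoherenceCosInversion
import Summits.AtomisticToContinuum.BoseEinsteinCondensation.Theorems.BECInfDivCoherenceGridInfDivCoherenceExpPosComb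
import HarnessLib

/-!
# Route `BECInfDivCoherence`, crux `GridInfDivCoherence` (stmt-AtomisticToContinuum-9114), line `registered`:
# the crux is EQUIVALENT to the line's load-bearing stub `stub_hadamardPowerCoherence`

Support file (`--supports stmt-AtomisticToContinuum-9114`; lead c2). The birth skeleton of the line
reduces the crux `GridInfDivCoherence` ("−log of the grid-sampled translation coherence `G` of
near-minimisers is conditionally negative definite on `(ℤ/m)³`, up to `ε`") to the Schoenberg-dual stub
`stub_hadamardPowerCoherence` ("every Hadamard power `G^t`, `0 < t ≤ 1`, has grid cosine transform
`≥ −εt` off the origin") via `stub_gridCharacterSum` + `stub_schoenbergLimit` (landed). This file proves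
the CONVERSE for the statements as filed (near-minimiser form, tolerances included), hence the
equivalence `gridInfDivCoherence_iff_hadamardPowerCoherence`:

* `expAlmostPosDef` — finite-group Schoenberg, forward direction, with tolerance: for an even grid
  function `F` on `(ℤ/m)³` with `F(0) = 0` and cosine transform `≥ −ε` off the origin, every `exp(tF)`,
  `0 < t ≤ 1`, has cosine transform `≥ −t·m³ε·e^{2m³ε}` (Fourier inversion `stub_cosInversionEven`;
  `F = ν₀ + F₊ − F₋` with `F₊` a non-negative cosine combination and `|F₋| ≤ m³ε`; the transform of
  `e^{tF₊}` is `≥ 0` by `stub_dftExpPosComb` (Schur products); `|e^{−tF₋} − 1| ≤ tm³ε·e^{tm³ε}` and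
  `ν₀ + F₊(0) = Σ_q ν_q⁻ ≤ m³ε` from `Σ_q ν_q = F(0) = 0`, `sum_levyWeight`);
* `hadamardPower_lower_bound` — the same for `F = log G ∘ nodes` of a periodic trial state
  (`stub_cohGridEven` for evenness, `coh_zero` for `F(0) = 0`, `Real.rpow_def_of_pos`);
* `hadamardPowerCoherence_of_gridInfDiv` — `GridInfDivCoherence →` the stub, verbatim: the stub's `ε'`
  comes AFTER `N`, so `m = ⌊L/η⌋₊` is known and the crux is fed with
  `ε := min(ε'/(3(m³+1)), 1/(2(m³+1)))` (`t·m³ε·e^{2m³ε} ≤ t(ε'/3)·e ≤ ε't`);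
* `gridInfDivCoherence_iff_hadamardPowerCoherence` — the equivalence (backward direction = the
  skeleton's `GridInfDivCoherence_of` with the stub as hypothesis).

Consequence for the line: its only open `sorry` is the crux itself in Schoenberg-dual (infinitely
divisible / compound-Poisson) form — neither weaker nor stronger. References: Schoenberg 1938;
Berg–Christensen–Ressel, *Harmonic Analysis on Semigroups* (1984) Ch. 3 Thm 2.2, Prop 2.7.
-/

noncomputable section

namespace Summit.AtomisticToContinuum.BoseEinsteinCondensation.Theorems

open Filter MeasureTheory
open scoped BigOperators ComplexConjugate ENNReal
open Literature.MathematicalPhysics.QuantumManyBody.BoseGas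
open Summit.AtomisticToContinuum.BoseEinsteinCondensation.Theses.BECInfDivCoherence

namespace HadamardEquiv

open Summit.AtomisticToContinuum.BoseEinsteinCondensation.Theorems.InfDivGlue in
/-- **Finite-group Schoenberg, forward direction, with tolerance** (pure; composition of
`stub_cosInversionEven` and `stub_dftExpPosComb`). For an even grid function `F` on `(ℤ/m)³` with
`F(0) = 0` whose cosine transform is `≥ −ε` off the origin, every `exp(tF)`, `0 < t ≤ 1`, has cosine
transform `≥ −t·m³ε·e^{2m³ε}` everywhere. [Schoenberg1938; BergChristensenRessel1984 Ch. 3 Thm 2.2] -/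
theorem expAlmostPosDef (m : ℕ) [NeZero m] (F : (Fin 3 → Fin m) → ℝ) (hev : ∀ j, F (-j) = F j)
    (h0 : F 0 = 0) {ε : ℝ} (hε : 0 ≤ ε)
    (hν : ∀ q : Fin 3 → Fin m, (∃ k, (q k : ℕ) ≠ 0) →
      -ε ≤ (∑ j : Fin 3 → Fin m, F j *
        Real.cos (2 * Real.pi * (∑ k, ((q k : ℕ) : ℝ) * ((j k : ℕ) : ℝ)) / m)) / (m : ℝ) ^ 3)
    {t : ℝ} (ht : 0 < t) (ht1 : t ≤ 1) (p : Fin 3 → Fin m) :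
    -(t * ((m : ℝ) ^ 3 * ε) * Real.exp (2 * ((m : ℝ) ^ 3 * ε))) ≤
      (∑ j : Fin 3 → Fin m, Real.exp (t * F j) *
        Real.cos (2 * Real.pi * (∑ k, ((p k : ℕ) : ℝ) * ((j k : ℕ) : ℝ)) / m)) / (m : ℝ) ^ 3 := by
  -- the elementary estimate `|eˣ − 1| ≤ |x| e^{|x|}`
  have abs_exp_sub_one_le : ∀ x : ℝ, |Real.exp x - 1| ≤ |x| * Real.exp |x| := by
    intro x
    rcases le_or_gt 0 x with hx | hx
    · have h1 : 0 ≤ Real.exp x - 1 := by linarith [Real.add_one_le_exp x]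
      rw [abs_of_nonneg h1, abs_of_nonneg hx]
      have h := Real.add_one_le_exp (-x)
      have hpos := Real.exp_pos x
      have h2 : (-x + 1) * Real.exp x ≤ Real.exp (-x) * Real.exp x :=
        mul_le_mul_of_nonneg_right h hpos.le
      rw [← Real.exp_add, neg_add_cancel, Real.exp_zero] at h2
      nlinarith
    · have h1 : Real.exp x < 1 := by rw [← Real.exp_zero]; exact Real.exp_lt_exp.2 hx
      rw [abs_of_neg (by linarith), abs_of_neg hx]
      have h2 := Real.add_one_le_exp x
      have h3 : (1 : ℝ) ≤ Real.exp (-x) := by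
        rw [← Real.exp_zero]; exact Real.exp_le_exp.2 (by linarith)
      nlinarith
  -- notation: phases, Lévy weights, their positive / negative parts off the origin
  set θ : (Fin 3 → Fin m) → (Fin 3 → Fin m) → ℝ := fun q j =>
    2 * Real.pi * (∑ k, ((q k : ℕ) : ℝ) * ((j k : ℕ) : ℝ)) / m with hθ
  set ν : (Fin 3 → Fin m) → ℝ := fun q => (∑ j, F j * Real.cos (θ q j)) / (m : ℝ) ^ 3 with hνdef
  have hmpos : (0 : ℝ) < m := by exact_mod_cast Nat.pos_of_ne_zero (NeZero.ne m)
  have hm3 : (0 : ℝ) < (m : ℝ) ^ 3 := by positivity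
  have hcard : (Finset.univ : Finset (Fin 3 → Fin m)).card = m ^ 3 := by
    rw [Finset.card_univ, Fintype.card_fun, Fintype.card_fin, Fintype.card_fin]
  set σ : ℝ := (m : ℝ) ^ 3 * ε with hσ
  have hσ0 : 0 ≤ σ := by positivity
  have hθq0 : ∀ q, θ q 0 = 0 := by intro q; simp [hθ]
  have hθ0j : ∀ j, θ 0 j = 0 := by intro j; simp [hθ]
  -- Fourier inversion (stub B0) and the total weight `Σ_q ν_q = F 0 = 0`
  have hinv : ∀ j, F j = ∑ q, ν q * Real.cos (θ q j) := stub_cosInversionEven m F hev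
  have hsumν : ∑ q, ν q = 0 := by rw [← h0]; exact sum_levyWeight F
  set νp : (Fin 3 → Fin m) → ℝ := fun q => if q = 0 then 0 else max (ν q) 0 with hνp
  set νm : (Fin 3 → Fin m) → ℝ := fun q => if q = 0 then 0 else max (-ν q) 0 with hνm
  have hνp0 : ∀ q, 0 ≤ νp q := by
    intro q; simp only [hνp]; split_ifs; · exact le_rfl
    · exact le_max_right _ _
  have hνm0 : ∀ q, 0 ≤ νm q := by
    intro q; simp only [hνm]; split_ifs; · exact le_rfl
    · exact le_max_right _ _
  have hνmε : ∀ q, νm q ≤ ε := by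
    intro q
    simp only [hνm]
    split_ifs with hq
    · exact hε
    · have hq' : ∃ k, (q k : ℕ) ≠ 0 := by
        by_contra hcon
        push Not at hcon
        exact hq (funext fun k => Fin.ext (by rw [hcon k]; simp))
      have := hν q hq'
      exact max_le (by linarith) hε
  have hcoef : ∀ q, ν q = (if q = 0 then ν 0 else 0) + (νp q - νm q) := by
    intro q
    by_cases hq : q = 0
    · subst hq; simp [hνp, hνm]
    · simp only [hνp, hνm, if_neg hq, zero_add]
      rcases le_total 0 (ν q) with h | h
      · rw [max_eq_left h, max_eq_right (by linarith)]; ring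
      · rw [max_eq_right h, max_eq_left (by linarith)]; ring
  set Fp : (Fin 3 → Fin m) → ℝ := fun j => ∑ q, νp q * Real.cos (θ q j) with hFp
  set Fm : (Fin 3 → Fin m) → ℝ := fun j => ∑ q, νm q * Real.cos (θ q j) with hFm
  have hdecomp : ∀ j, F j = ν 0 + Fp j - Fm j := by
    intro j
    rw [hinv j]
    have : ∀ q, ν q * Real.cos (θ q j) =
        (if q = 0 then ν 0 else 0) + (νp q * Real.cos (θ q j) - νm q * Real.cos (θ q j)) := by
      intro q
      by_cases hq : q = 0
      · subst hq; simp [hνp, hνm, hθ0j]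
      · rw [hcoef q]; simp only [if_neg hq]; ring
    rw [Finset.sum_congr rfl fun q _ => this q, Finset.sum_add_distrib, Finset.sum_ite_eq']
    simp only [Finset.mem_univ, if_true, Finset.sum_sub_distrib]
    ring
  -- bounds: `|F₋| ≤ σ`, `F₊ ≤ F₊(0)`, `ν 0 + F₊(0) = Σ ν⁻ ≤ σ`
  have hFm_le : ∀ j, |Fm j| ≤ σ := by
    intro j
    calc |Fm j| ≤ ∑ q, |νm q * Real.cos (θ q j)| := Finset.abs_sum_le_sum_abs _ _
      _ ≤ ∑ _q : Fin 3 → Fin m, ε := Finset.sum_le_sum fun q _ => by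
          rw [abs_mul, abs_of_nonneg (hνm0 q)]
          calc νm q * |Real.cos (θ q j)| ≤ ε * 1 :=
                mul_le_mul (hνmε q) (Real.abs_cos_le_one _) (abs_nonneg _) hε
            _ = ε := mul_one ε
      _ = σ := by rw [Finset.sum_const, hcard, nsmul_eq_mul]; push_cast; ring
  have hFp_le : ∀ j, Fp j ≤ Fp 0 := by
    intro j
    refine Finset.sum_le_sum fun q _ => ?_
    rw [hθq0, Real.cos_zero, mul_one]
    exact mul_le_of_le_one_right (hνp0 q) (Real.cos_le_one _)
  have hkey : ν 0 + Fp 0 ≤ σ := by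
    have h1 : ∑ q, ν q = ν 0 + (∑ q, νp q - ∑ q, νm q) := by
      rw [Finset.sum_congr rfl fun q _ => hcoef q, Finset.sum_add_distrib, Finset.sum_ite_eq',
        Finset.sum_sub_distrib]
      simp
    have h2 : Fp 0 = ∑ q, νp q := by
      simp only [hFp]
      exact Finset.sum_congr rfl fun q _ => by rw [hθq0, Real.cos_zero, mul_one]
    have h3 : ∑ q, νm q ≤ σ :=
      (Finset.sum_le_sum fun q _ => hνmε q).trans
        (by rw [Finset.sum_const, hcard, nsmul_eq_mul]; push_cast; rw [hσ])
    linarith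
  -- the main decomposition `e^{tF} = e^{tν₀} (e^{tF₊} + e^{tF₊}(e^{−tF₋} − 1))`
  have hmain : ∑ j, Real.exp (t * F j) * Real.cos (θ p j) =
      Real.exp (t * ν 0) * (∑ j, Real.exp (t * Fp j) * Real.cos (θ p j) +
        ∑ j, Real.exp (t * Fp j) * (Real.exp (-(t * Fm j)) - 1) * Real.cos (θ p j)) := by
    rw [← Finset.sum_add_distrib, Finset.mul_sum]
    refine Finset.sum_congr rfl fun j _ => ?_
    rw [hdecomp j, show t * (ν 0 + Fp j - Fm j) = t * ν 0 + t * Fp j + -(t * Fm j) by ring,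
      Real.exp_add, Real.exp_add]
    ring
  -- sign of the first sum (stub B1 with coefficients `t νp ≥ 0`)
  have hpos1 : 0 ≤ ∑ j, Real.exp (t * Fp j) * Real.cos (θ p j) := by
    have h := stub_dftExpPosComb m (fun q => t * νp q) (fun q => mul_nonneg ht.le (hνp0 q)) p
    have hre : ∀ j, t * Fp j = ∑ q, t * νp q * Real.cos (θ q j) := by
      intro j; simp only [hFp]; rw [Finset.mul_sum]
      exact Finset.sum_congr rfl fun q _ => by ring
    simpa only [hre] using h
  -- size of the second sum
  have hneg : |∑ j, Real.exp (t * Fp j) * (Real.exp (-(t * Fm j)) - 1) * Real.cos (θ p j)| ≤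
      (m : ℝ) ^ 3 * (Real.exp (t * Fp 0) * (t * σ * Real.exp (t * σ))) := by
    calc |∑ j, Real.exp (t * Fp j) * (Real.exp (-(t * Fm j)) - 1) * Real.cos (θ p j)|
        ≤ ∑ j, |Real.exp (t * Fp j) * (Real.exp (-(t * Fm j)) - 1) * Real.cos (θ p j)| :=
          Finset.abs_sum_le_sum_abs _ _
      _ ≤ ∑ _j : Fin 3 → Fin m, Real.exp (t * Fp 0) * (t * σ * Real.exp (t * σ)) := by
          refine Finset.sum_le_sum fun j _ => ?_
          rw [abs_mul, abs_mul, abs_of_pos (Real.exp_pos _)]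
          have e1 : Real.exp (t * Fp j) ≤ Real.exp (t * Fp 0) :=
            Real.exp_le_exp.2 (mul_le_mul_of_nonneg_left (hFp_le j) ht.le)
          have hb : |-(t * Fm j)| ≤ t * σ := by
            rw [abs_neg, abs_mul, abs_of_pos ht]
            exact mul_le_mul_of_nonneg_left (hFm_le j) ht.le
          have e2 : |Real.exp (-(t * Fm j)) - 1| ≤ t * σ * Real.exp (t * σ) :=
            (abs_exp_sub_one_le _).trans
              (mul_le_mul hb (Real.exp_le_exp.2 hb) (Real.exp_pos _).le (by positivity))
          calc Real.exp (t * Fp j) * |Real.exp (-(t * Fm j)) - 1| * |Real.cos (θ p j)|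
              ≤ Real.exp (t * Fp j) * |Real.exp (-(t * Fm j)) - 1| * 1 :=
                mul_le_mul_of_nonneg_left (Real.abs_cos_le_one _) (by positivity)
            _ ≤ Real.exp (t * Fp 0) * (t * σ * Real.exp (t * σ)) := by
                rw [mul_one]
                exact mul_le_mul e1 e2 (abs_nonneg _) (Real.exp_pos _).le
      _ = (m : ℝ) ^ 3 * (Real.exp (t * Fp 0) * (t * σ * Real.exp (t * σ))) := by
          rw [Finset.sum_const, hcard, nsmul_eq_mul]; push_cast; ring
  -- assemble: `Σ ≥ −e^{tν₀}·m³ e^{tF₊(0)} tσ e^{tσ} ≥ −m³ tσ e^{2σ}`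
  have hexp3 : Real.exp (t * ν 0) * Real.exp (t * Fp 0) * Real.exp (t * σ) ≤ Real.exp (2 * σ) := by
    rw [← Real.exp_add, ← Real.exp_add, Real.exp_le_exp]
    nlinarith
  have hlow : -((m : ℝ) ^ 3 * (t * σ * Real.exp (2 * σ))) ≤
      ∑ j, Real.exp (t * F j) * Real.cos (θ p j) := by
    rw [hmain]
    have hab := neg_abs_le (∑ j, Real.exp (t * Fp j) * (Real.exp (-(t * Fm j)) - 1) * Real.cos (θ p j))
    have he0 := Real.exp_pos (t * ν 0)
    calc -((m : ℝ) ^ 3 * (t * σ * Real.exp (2 * σ)))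
        ≤ -((m : ℝ) ^ 3 * (t * σ * (Real.exp (t * ν 0) * Real.exp (t * Fp 0) * Real.exp (t * σ)))) := by
          have : (m : ℝ) ^ 3 * (t * σ * (Real.exp (t * ν 0) * Real.exp (t * Fp 0) * Real.exp (t * σ))) ≤
              (m : ℝ) ^ 3 * (t * σ * Real.exp (2 * σ)) := by gcongr
          linarith
      _ = Real.exp (t * ν 0) * (0 + -((m : ℝ) ^ 3 * (Real.exp (t * Fp 0) * (t * σ * Real.exp (t * σ))))) := by
          ring
      _ ≤ Real.exp (t * ν 0) * (∑ j, Real.exp (t * Fp j) * Real.cos (θ p j) +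
          ∑ j, Real.exp (t * Fp j) * (Real.exp (-(t * Fm j)) - 1) * Real.cos (θ p j)) :=
          mul_le_mul_of_nonneg_left (add_le_add hpos1 (by linarith)) he0.le
  rw [le_div_iff₀ hm3]
  have : -(t * ((m : ℝ) ^ 3 * ε) * Real.exp (2 * ((m : ℝ) ^ 3 * ε))) * (m : ℝ) ^ 3 =
      -((m : ℝ) ^ 3 * (t * σ * Real.exp (2 * σ))) := by rw [hσ]; ring
  rw [this]
  exact hlow

open Summit.AtomisticToContinuum.BoseEinsteinCondensation.Theorems.InfDivGlue in
/-- **Hadamard powers from the Lévy floor** (soft, explicit form: composition of `stub_cohGridEven`,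
`coh_zero` and `expAlmostPosDef`). For a periodic trial state with translation coherence `G > 0` whose
grid Lévy weights are `≥ −ε` off the origin, every Hadamard power `G^t`, `0 < t ≤ 1`, sampled on the grid
has cosine transform `≥ −t·m³ε·e^{2m³ε}`. [Schoenberg1938; BergChristensenRessel1984 Ch. 3 Thm 2.2] -/
theorem hadamardPower_lower_bound {N : ℕ} {L : ℝ} (hL : 0 < L) {m : ℕ} [NeZero m]
    (Ψ : PeriodicTrialState N L) (i : Fin N) (G : EuclideanSpace ℝ (Fin 3) → ℝ)
    (hGdef : ∀ r, G r =
      (∫ X in cellN N L, conj (Ψ.ψ (Function.update X i (X i + r))) * Ψ.ψ X).re)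
    {ε : ℝ} (hε : 0 ≤ ε) (hpos : ∀ r, 0 < G r)
    (hlevy : ∀ q : Fin 3 → Fin m, (∃ k, (q k : ℕ) ≠ 0) →
      -ε ≤ (∑ j : Fin 3 → Fin m, Real.log (G (latticeVec (L / m) fun k => ((j k : ℕ) : ℤ))) *
        Real.cos (2 * Real.pi * (∑ k, ((q k : ℕ) : ℝ) * ((j k : ℕ) : ℝ)) / m)) / (m : ℝ) ^ 3)
    {t : ℝ} (ht : 0 < t) (ht1 : t ≤ 1) (q : Fin 3 → Fin m) :
    -(t * ((m : ℝ) ^ 3 * ε) * Real.exp (2 * ((m : ℝ) ^ 3 * ε))) ≤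
      (∑ j : Fin 3 → Fin m, G (latticeVec (L / m) fun k => ((j k : ℕ) : ℤ)) ^ t *
        Real.cos (2 * Real.pi * (∑ k, ((q k : ℕ) : ℝ) * ((j k : ℕ) : ℝ)) / m)) / (m : ℝ) ^ 3 := by
  set F : (Fin 3 → Fin m) → ℝ := fun j =>
    Real.log (G (latticeVec (L / m) fun k => ((j k : ℕ) : ℤ))) with hF
  have hev : ∀ j, F (-j) = F j := by
    intro j
    simp only [hF, hGdef]
    rw [stub_cohGridEven N L hL m Ψ i j]
  have h0 : F 0 = 0 := by
    simp only [hF]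
    have hz : (fun k => (((0 : Fin 3 → Fin m) k : ℕ) : ℤ)) = 0 := by
      funext k; simp
    rw [hz, latticeVec_zero, hGdef, coh_zero Ψ i, Real.log_one]
  have h := expAlmostPosDef m F hev h0 hε hlevy ht ht1 q
  have hpow : ∀ j : Fin 3 → Fin m, Real.exp (t * F j) =
      G (latticeVec (L / m) fun k => ((j k : ℕ) : ℤ)) ^ t := by
    intro j
    rw [Real.rpow_def_of_pos (hpos _), mul_comm]
  simpa only [hpow] using h

end HadamardEquiv

open HadamardEquiv

/-- **The crux implies Stub 1** (`GridInfDivCoherence → stub_hadamardPowerCoherence`, verbatim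
signature of the stub): same `η, ρ₀`, same eventual `N`-set; given the stub's `ε' > 0` AFTER `N` (so
`m = ⌊L/η⌋₊` is known), feed the crux with `ε := min(ε'/(3(m³+1)), 1/(2(m³+1)))`, carry positivity,
and apply `hadamardPower_lower_bound` (`t·m³ε·e^{2m³ε} ≤ t·(ε'/3)·e ≤ ε'·t`). Hence the remaining stub of
the line is EQUIVALENT to the crux (`gridInfDivCoherence_iff_hadamardPowerCoherence`). [folklore] -/
theorem hadamardPowerCoherence_of_gridInfDiv (hG : GridInfDivCoherence) :
    ∀ v : ℝ → ℝ≥0∞, IsRepulsiveFiniteRange v → ∃ η : ℝ, 0 < η ∧ ∃ ρ₀ : ℝ, 0 < ρ₀ ∧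
      ∀ ρ : ℝ, 0 < ρ → ρ < ρ₀ → ∀ᶠ N : ℕ in atTop, ∀ ε : ℝ, 0 < ε → ∃ δ : ℝ≥0∞, 0 < δ ∧
        ∀ Ψ : PeriodicTrialState N (sideLength ρ N),
          periodicEnergy v Ψ ≤ periodicGroundStateEnergy v N (sideLength ρ N) + δ →
          ∀ i : Fin N,
            let L : ℝ := sideLength ρ N
            let m : ℕ := ⌊L / η⌋₊
            let G : EuclideanSpace ℝ (Fin 3) → ℝ := fun r =>
              (∫ X in cellN N L, conj (Ψ.ψ (Function.update X i (X i + r))) * Ψ.ψ X).re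
            (∀ r, 0 < G r) ∧ ∀ q : Fin 3 → Fin m, (∃ k, (q k : ℕ) ≠ 0) →
              ∀ t : ℝ, 0 < t → t ≤ 1 →
                -(ε * t) ≤ (∑ j : Fin 3 → Fin m,
                  G (latticeVec (L / m) (fun k => ((j k : ℕ) : ℤ))) ^ t *
                    Real.cos (2 * Real.pi * (∑ k, ((q k : ℕ) : ℝ) * ((j k : ℕ) : ℝ)) / m)) /
                  (m : ℝ) ^ 3 := by
  intro v hv
  obtain ⟨η, hη, ρ₀, hρ₀, H⟩ := hG v hv
  refine ⟨η, hη, ρ₀, hρ₀, fun ρ hρ hρlt => ?_⟩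
  filter_upwards [H ρ hρ hρlt] with N hN
  intro ε hε
  -- the grid size is known at this point: choose the crux tolerance `ε₁`
  set M : ℝ := ((⌊sideLength ρ N / η⌋₊ : ℕ) : ℝ) ^ 3 with hM
  have hM0 : 0 ≤ M := by positivity
  set ε₁ : ℝ := min (ε / (3 * (M + 1))) (1 / (2 * (M + 1))) with hε₁
  have hε₁pos : 0 < ε₁ := by positivity
  have hε₁a : M * ε₁ ≤ ε / 3 := by
    calc M * ε₁ ≤ M * (ε / (3 * (M + 1))) := mul_le_mul_of_nonneg_left (min_le_left _ _) hM0
      _ ≤ ε / 3 := by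
          rw [mul_div_assoc', div_le_div_iff₀ (by positivity) (by positivity)]
          nlinarith
  have hε₁b : M * ε₁ ≤ 1 / 2 := by
    calc M * ε₁ ≤ M * (1 / (2 * (M + 1))) := mul_le_mul_of_nonneg_left (min_le_right _ _) hM0
      _ ≤ 1 / 2 := by
          rw [mul_div_assoc', div_le_div_iff₀ (by positivity) (by positivity)]
          nlinarith
  obtain ⟨δ, hδ, HΨ⟩ := hN ε₁ hε₁pos
  refine ⟨δ, hδ, fun Ψ hΨ i => ?_⟩
  have h := HΨ Ψ hΨ i
  dsimp only at h ⊢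
  obtain ⟨hpos, hlevy⟩ := h
  refine ⟨hpos, fun q hq t ht ht1 => ?_⟩
  have hm : 0 < ⌊sideLength ρ N / η⌋₊ := Fin.pos (q 0)
  haveI : NeZero ⌊sideLength ρ N / η⌋₊ := ⟨hm.ne'⟩
  have hN0 : 0 < N := Fin.pos i
  have hLpos : 0 < sideLength ρ N := by
    unfold sideLength
    exact Real.rpow_pos_of_pos (div_pos (Nat.cast_pos.2 hN0) hρ) _
  have hb := hadamardPower_lower_bound hLpos Ψ i
    (fun r => (∫ X in cellN N (sideLength ρ N),
      conj (Ψ.ψ (Function.update X i (X i + r))) * Ψ.ψ X).re)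
    (fun r => rfl) hε₁pos.le hpos hlevy ht ht1 q
  refine le_trans ?_ hb
  -- `t · Mε₁ · e^{2Mε₁} ≤ ε t`
  rw [neg_le_neg_iff, ← hM]
  have he : Real.exp (2 * (M * ε₁)) ≤ 3 := by
    have h1 : Real.exp (2 * (M * ε₁)) ≤ Real.exp 1 := Real.exp_le_exp.2 (by linarith)
    have h2 := Real.exp_one_lt_d9
    linarith
  calc t * (M * ε₁) * Real.exp (2 * (M * ε₁)) ≤ t * (ε / 3) * 3 := by
        gcongr
    _ = ε * t := by ring

/-- **Crux-equivalence of the line** (lead c2): the crux `GridInfDivCoherence` is EQUIVALENT to the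
line's remaining stub `stub_hadamardPowerCoherence` ("coherence is infinitely divisible", Hadamard-power
form with the natural `−εt` tolerance) — finite-group Schoenberg in both directions, tolerances carried
exactly. So the open `sorry` of this skeleton is the crux itself in Schoenberg-dual form, neither weaker
nor stronger. [Schoenberg1938; BergChristensenRessel1984 Ch. 3 Thm 2.2, Prop 2.7] -/
theorem gridInfDivCoherence_iff_hadamardPowerCoherence :
    GridInfDivCoherence ↔
    ∀ v : ℝ → ℝ≥0∞, IsRepulsiveFiniteRange v → ∃ η : ℝ, 0 < η ∧ ∃ ρ₀ : ℝ, 0 < ρ₀ ∧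
      ∀ ρ : ℝ, 0 < ρ → ρ < ρ₀ → ∀ᶠ N : ℕ in atTop, ∀ ε : ℝ, 0 < ε → ∃ δ : ℝ≥0∞, 0 < δ ∧
        ∀ Ψ : PeriodicTrialState N (sideLength ρ N),
          periodicEnergy v Ψ ≤ periodicGroundStateEnergy v N (sideLength ρ N) + δ →
          ∀ i : Fin N,
            let L : ℝ := sideLength ρ N
            let m : ℕ := ⌊L / η⌋₊
            let G : EuclideanSpace ℝ (Fin 3) → ℝ := fun r =>
              (∫ X in cellN N L, conj (Ψ.ψ (Function.update X i (X i + r))) * Ψ.ψ X).re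
            (∀ r, 0 < G r) ∧ ∀ q : Fin 3 → Fin m, (∃ k, (q k : ℕ) ≠ 0) →
              ∀ t : ℝ, 0 < t → t ≤ 1 →
                -(ε * t) ≤ (∑ j : Fin 3 → Fin m,
                  G (latticeVec (L / m) (fun k => ((j k : ℕ) : ℤ))) ^ t *
                    Real.cos (2 * Real.pi * (∑ k, ((q k : ℕ) : ℝ) * ((j k : ℕ) : ℝ)) / m)) /
                  (m : ℝ) ^ 3 := by
  refine ⟨hadamardPowerCoherence_of_gridInfDiv, fun h1 => ?_⟩
  -- Stub 1 implies the crux (the composition of `GridInfDivCoherence_of`, with the hypothesis in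
  -- place of the stub): the dual-side Schoenberg limit against each non-trivial character
  intro v hv
  obtain ⟨η, hη, ρ₀, hρ₀, hρ⟩ := h1 v hv
  refine ⟨η, hη, ρ₀, hρ₀, fun ρ hρpos hρlt => ?_⟩
  filter_upwards [hρ ρ hρpos hρlt] with N hN
  intro ε hε
  obtain ⟨δ, hδ, hΨ⟩ := hN ε hε
  refine ⟨δ, hδ, fun Ψ hΨle i => ?_⟩
  have h := hΨ Ψ hΨle i
  intro L m G
  obtain ⟨hpos, hpow⟩ := h
  refine ⟨hpos, fun q hq => ?_⟩
  have hm : 0 < m := Fin.pos (q 0)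
  have hs : (0 : ℝ) < (m : ℝ) ^ 3 := pow_pos (Nat.cast_pos.mpr hm) 3
  exact stub_schoenbergLimit (Fin 3 → Fin m)
    (fun j => G (latticeVec (L / m) fun k => ((j k : ℕ) : ℤ)))
    (fun j => Real.cos (2 * Real.pi * (∑ k, ((q k : ℕ) : ℝ) * ((j k : ℕ) : ℝ)) / m))
    ((m : ℝ) ^ 3) hs (fun j => hpos _) (stub_gridCharacterSum m q hq) ε
    (fun t ht ht1 => hpow q hq t ht ht1)

end Summit.AtomisticToContinuum.BoseEinsteinCondensation.Theorems

end
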